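import Summits.HodgeConjecture.HodgeConjecture.Theses.SaitoKurokawaBridge
import Literature.AlgebraicGeometry.HodgeTheory.ComplexOrientationFamily
import Literature.AlgebraicGeometry.HodgeTheory.SupportedClassesIrreducibleSupports
import Literature.AlgebraicGeometry.HodgeTheory.GysinFormalismPushforward

/-!
# Stub 1 of the birth skeleton of `SupportedBridgeClassesVanish` (item 3276), PROVED:
# classes dying off `pr_X⁻¹(X')` are sums of Gysin images from smooth projective `T → Y ⊗ X` over `X'`

`stub_gysinSpanOverProperClosed_proof`: Deligne, Hodge III Cor. 8.2.8 with Hironaka, for the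
(reducible) closed set `pr_X⁻¹(X') ⊊ Y ⊗ X` — assembled from the tree's
`mem_iSup_ker_restrictCompl_irreducible` (reduction to irreducible closed `W ⊆ pr_X⁻¹(X')`),
`exists_resolution_ker_restrictCompl_eq` (one irreducible support: `K_W = Σ_a im g_*` for a resolution
`g : T → W`), `one_le_coheight_of_mem_of_isClosed` (points of a proper closed subset have codimension
`≥ 1`) and the surjectivity of `pr_X` on points. With it the skeleton
`BirthSupportedBridgeClassesVanish.lean` has ONE open stub left: `stub_pullbackVanishOfNotDominant`
(Hodge III 8.2.5 weights + `H^{n,0} = H^{0,n} = 0` below dimension `n`).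
-/

set_option linter.dupNamespace false

open CategoryTheory MonoidalCategory AlgebraicGeometry
open Literature.AlgebraicGeometry Literature.AlgebraicGeometry.HodgeTheory
open Literature.AlgebraicTopology.SingularHomology

namespace Summit.HodgeConjecture.HodgeConjecture.Cruxes.ExtremeBridgeFailure.SupportedVanish

open Summit.HodgeConjecture.HodgeConjecture.Theses.SaitoKurokawaBridge
open CartesianMonoidalCategory SemiCartesianMonoidalCategory

/-- The structure morphism of a smooth projective variety is surjective (`Spec ℂ` is one point and
the variety is non-empty, being irreducible). -/
theorem surjective_hom_of_isSmoothProjective {n : ℕ} {Y : Motives.SchemeOver ℂ}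
    (hY : Motives.IsSmoothProjective n Y) : Surjective Y.hom := by
  haveI : IrreducibleSpace Y.left :=
    haveI := hY.geometricallyIrreducible
    GeometricallyIrreducible.irreducibleSpace_of_subsingleton Y.hom
  exact ⟨fun s ↦ ⟨genericPoint Y.left, Subsingleton.elim _ _⟩⟩

/-- **Stub 1 of the skeleton of item 3276, proved.** -/
theorem stub_gysinSpanOverProperClosed_proof :
    ∀ (n : ℕ) (Y X : Motives.SchemeOver ℂ) (hY : Motives.IsSmoothProjective n Y)
      (hX : Motives.IsSmoothProjective n X) (X' : Set X.left), IsClosed X' → X' ≠ Set.univ →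
      ∀ κ : complexBetti (Y ⊗ X) (2 * n),
        complexBetti.restrictCompl (Y ⊗ X) ((snd Y X).left.base ⁻¹' X') (2 * n) κ = 0 →
        κ ∈ ⨆ (d : ℕ) (T : Motives.SchemeOver ℂ) (hT : Motives.IsSmoothProjective d T) (g : T ⟶ Y ⊗ X)
          (_ : Set.range (g ≫ snd Y X).left.base ⊆ X') (e : ℕ) (he : e + 2 * (n + n) = 2 * n + 2 * d),
          LinearMap.range (complexGysin complexOrientationFamily hT
            (Motives.IsSmoothProjective.tensor_holds hY hX) g he) := by
  intro n Y X hY hX X' hX'c hX'u κ hκ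
  have hYX := Motives.IsSmoothProjective.tensor_holds hY hX
  have hPD := hasPoincareDuality_complexOrientationFamily
  set Z : Set (Y ⊗ X).left := (snd Y X).left.base ⁻¹' X' with hZ
  have hZc : IsClosed Z := hX'c.preimage (snd Y X).left.base.hom.continuous
  -- `Z ≠ univ`: `pr_X` is onto
  have hZne : Z ≠ Set.univ := by
    intro hZu
    apply hX'u
    haveI := surjective_hom_of_isSmoothProjective hY
    have hs : Function.Surjective (snd Y X).left.base := (snd Y X).left.surjective
    refine Set.eq_univ_of_forall fun x ↦ ?_
    obtain ⟨z, rfl⟩ := hs x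
    have : z ∈ Z := by rw [hZu]; exact Set.mem_univ z
    exact this
  have hZ1 : ∀ z ∈ Z, (1 : ℕ∞) ≤ Order.coheight z := fun z hz ↦
    one_le_coheight_of_mem_of_isClosed hYX hZc hZne hz
  have hmem := mem_iSup_ker_restrictCompl_irreducible hYX hZc hZ1 hκ
  refine SetLike.le_def.mp (iSup_le fun W ↦ iSup_le fun hWc ↦ iSup_le fun hWi ↦ iSup_le fun hWZ ↦ ?_) hmem
  obtain ⟨d, T, hT, g, -, hrange, hker⟩ :=
    exists_resolution_ker_restrictCompl_eq hYX complexOrientationFamily hPD hWc hWi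
  rw [hker (2 * n)]
  refine iSup_le fun e ↦ iSup_le fun he ↦ ?_
  have hg : Set.range (g ≫ snd Y X).left.base ⊆ X' := by
    rintro _ ⟨t, rfl⟩
    have ht : g.left.base t ∈ W := hrange ▸ Set.mem_range_self t
    have hz : g.left.base t ∈ Z := hWZ ht
    simpa only [hZ, Set.mem_preimage, Over.comp_left, Scheme.Hom.comp_base, TopCat.coe_comp,
      Function.comp_apply] using hz
  exact le_iSup_of_le d (le_iSup_of_le T (le_iSup_of_le hT (le_iSup_of_le g (le_iSup_of_le hg
    (le_iSup_of_le e (le_iSup_of_le he le_rfl))))))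

end Summit.HodgeConjecture.HodgeConjecture.Cruxes.ExtremeBridgeFailure.SupportedVanish
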